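import Summits.CriticalPhenomena.PercolationContinuityZ3.Theorems.PercNearOneGluingNoHeavyLowerTailSahiE3UnionTensorLattice
import Summits.CriticalPhenomena.PercolationContinuityZ3.Theorems.PercNearOneGluingNoHeavyLowerTailSahiE3UnionTensorMixed
import Summits.CriticalPhenomena.PercolationContinuityZ3.Theorems.PercNearOneGluingNoHeavyLowerTailSahiE3UnionTensorMixedOAA
import Summits.CriticalPhenomena.PercolationContinuityZ3.Theorems.PercNearOneGluingNoHeavyLowerTailSahiC3CubeFourFKGLattices
import Literature.Combinatorics.Sahi2008.Symmetry
import Literature.Combinatorics.Sahi2008.FKG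
import HarnessLib

/-!
# `NoHeavyLowerTail` (crux stmt-CriticalPhenomena-4575), Sahi programme P4: `E₃ ≥ 0` is preserved by EVERY member-wise AND/OR gate
# between two independent positively associated blocks — one statement for all eight gate patterns, and the iteration package

Support file (cell `prim-l12`, seat P4, generation 33; `--supports stmt-CriticalPhenomena-4575`).  No definitions, no named facts, no sorries;
standard axioms.  It packages the four gate patterns proved in generation 32 — OOO (`…SahiE3UnionTensorLattice.sahiE_three_por_nonneg_of_sahiPositive_two`),
AAA (`sahiE_three_pand_nonneg_of_sahiPositive_two`), OOA (`…Mixed.sahiE_three_ooa_nonneg_of_sahiPositive_two`), OAA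
(`…MixedOAA.sahiE_three_oaa_nonneg_of_sahiPositive_two`) — with the symmetry of `E₃` (`sahiE_comp_perm`) into ONE theorem indexed by a gate vector
`g : Fin 3 → Bool` (`true` = OR, `false` = AND):

* `sahiE_three_gate_nonneg_of_sahiPositive_two` — `γ`, `β` finite preorders with probability weights `μ`, `ν` that are Sahi-positive of order `2`
  (positive association); `a_i : γ → [0,1]`, `b_i : β → [0,1]` monotone with `E₃(a) ≥ 0` under `μ` and `E₃(b) ≥ 0` under `ν`.  Then for EVERY
  `g : Fin 3 → Bool` the gate triple `u_i = a_i ⊕ b_i − a_ib_i` (`g i = true`) / `u_i = a_ib_i` (`g i = false`) on `γ × β` has `E₃(u) ≥ 0` under `μ ⊗ ν`.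
* THE ITERATION PACKAGE: `gateSlot_nonneg`, `gateSlot_le_one`, `monotone_gateSlot` (the gate triple is again a monotone `[0,1]`-triple on the product
  preorder) and `sahiE_three_gate_nonneg_of_fkg` (FKG weights on finite distributive lattices; with `isFKGMeasure_prod` the product is again FKG):
  hence, by induction over any binary bracketing of finitely many independent FKG blocks — at each internal node an arbitrary gate per member —
  **every GATE-SEPARABLE triple has `E₃ ≥ 0` as soon as each leaf block satisfies `C₃` for its own leaf triple** (leaves available in the tree:
  `2^X` with `|X| ≤ 4` and any FKG weight, `SahiC3CubeFourFKG.sahiPositive_three_set_of_card_le_four`; `2^ι` with `|ι| ≤ 6` and any product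
  weight, `SahiC3SixAnyIndex.sahiPositive_three_bernoulliWeight_of_card_le_six`, computational).
* `sahiE_three_gate_nonneg_set_of_card_le_four` — the unconditional two-block instance `2^X × 2^Y`, `|X|, |Y| ≤ 4`, arbitrary FKG block weights,
  arbitrary gates (extends generation 32's `…_set_of_card_le_three`, which was all-OR).
HONEST FRAMING: closure/inheritance statements; `C₃` itself (Sahi's Conjecture 5 at `n = 3` / Kahn's Conjecture 5) is not asserted.  The law-level
frontier is sharp in one direction: for GENERAL increasing events on `γ × coin` (nested pairs `P_j ∪ (H ∩ Q_j)` rather than member-wise gates) the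
analogous closure is FALSE even for lattice-positive, positively associated laws (tree: `…SahiMixtureLatticeBarrier`, masterthm-P3). [this work]
-/

noncomputable section

namespace Summit.CriticalPhenomena.PercolationContinuityZ3.Theorems.SahiE3UnionTensor

open Finset Function Literature.Combinatorics.Sahi2008

section Gates

variable {γ β : Type*} [Fintype γ] [Fintype β]

/-! ### The gate slots: nonnegative, at most one, monotone -/

/-- A gate slot `a ⊕ b − ab` (OR, `g = true`) or `ab` (AND, `g = false`) of `[0,1]`-valued inputs is nonnegative. [this work] -/
theorem gateSlot_nonneg (g : Bool) {s t : ℝ} (hs0 : 0 ≤ s) (ht0 : 0 ≤ t) (ht1 : t ≤ 1) :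
    0 ≤ cond g (s + t - s * t) (s * t) := by
  cases g
  · exact mul_nonneg hs0 ht0
  · show 0 ≤ s + t - s * t
    nlinarith [mul_nonneg hs0 (sub_nonneg.2 ht1), ht0]

/-- A gate slot of `[0,1]`-valued inputs is at most one. [this work] -/
theorem gateSlot_le_one (g : Bool) {s t : ℝ} (hs1 : s ≤ 1) (ht0 : 0 ≤ t) (ht1 : t ≤ 1) :
    cond g (s + t - s * t) (s * t) ≤ 1 := by
  cases g
  · show s * t ≤ 1
    nlinarith [mul_le_mul hs1 ht1 ht0 zero_le_one]
  · show s + t - s * t ≤ 1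
    nlinarith [mul_nonneg (sub_nonneg.2 hs1) (sub_nonneg.2 ht1)]

variable [Preorder γ] [Preorder β]

omit [Fintype γ] [Fintype β] in
/-- **The gate triple is again a monotone triple on the product preorder** (so the step iterates): for monotone `[0,1]`-valued `a : γ → ℝ`,
`b : β → ℝ`, the slot `p ↦ a(p.1) ⊕ b(p.2) − a(p.1)b(p.2)` resp. `p ↦ a(p.1)b(p.2)` is monotone on `γ × β`. [this work] -/
theorem monotone_gateSlot (g : Bool) {a : γ → ℝ} {b : β → ℝ} (ha0 : ∀ x, 0 ≤ a x) (ha1 : ∀ x, a x ≤ 1) (ham : Monotone a)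
    (hb0 : ∀ y, 0 ≤ b y) (hb1 : ∀ y, b y ≤ 1) (hbm : Monotone b) :
    Monotone (fun p : γ × β => cond g (a p.1 + b p.2 - a p.1 * b p.2) (a p.1 * b p.2)) := by
  intro p q hpq
  have h1 : a p.1 ≤ a q.1 := ham hpq.1
  have h2 : b p.2 ≤ b q.2 := hbm hpq.2
  cases g
  · show a p.1 * b p.2 ≤ a q.1 * b q.2
    exact mul_le_mul h1 h2 (hb0 _) (ha0 _)
  · show a p.1 + b p.2 - a p.1 * b p.2 ≤ a q.1 + b q.2 - a q.1 * b q.2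
    -- (1 - a q)(1 - b q) ≤ (1 - a p)(1 - b p)
    nlinarith [mul_le_mul (sub_le_sub_left h1 1) (sub_le_sub_left h2 1) (sub_nonneg.2 (hb1 q.2)) (sub_nonneg.2 (ha1 p.1)),
      ha1 q.1, hb1 p.2]

/-! ### One theorem for all eight gate patterns -/

omit [Preorder γ] [Preorder β] in
/-- Bookkeeping: the gate family reindexed by a permutation `σ` of the members has the same `E₃` (symmetry of Sahi's functional). [this work] -/
theorem sahiE_three_gate_comp_perm (w : γ × β → ℝ) (g : Fin 3 → Bool) (a : Fin 3 → γ → ℝ) (b : Fin 3 → β → ℝ) (σ : Equiv.Perm (Fin 3)) :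
    sahiE w 3 (fun (i : Fin 3) (p : γ × β) => cond (g (σ i)) (a (σ i) p.1 + b (σ i) p.2 - a (σ i) p.1 * b (σ i) p.2) (a (σ i) p.1 * b (σ i) p.2)) =
      sahiE w 3 (fun (i : Fin 3) (p : γ × β) => cond (g i) (a i p.1 + b i p.2 - a i p.1 * b i p.2) (a i p.1 * b i p.2)) :=
  sahiE_comp_perm w 3 σ (fun (i : Fin 3) (p : γ × β) => cond (g i) (a i p.1 + b i p.2 - a i p.1 * b i p.2) (a i p.1 * b i p.2))

/-- The four SORTED gate patterns (ORs first): `ttt`, `ttf`, `tff`, `fff` — generation 32's four theorems, restated for the `cond` family. [this work] -/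
theorem sahiE_three_gate_nonneg_sorted (μ : γ → ℝ) (ν : β → ℝ)
    (hμ0 : ∀ t, 0 ≤ μ t) (hμ1 : ∑ t, μ t = 1) (hν0 : ∀ t, 0 ≤ ν t) (hν1 : ∑ t, ν t = 1)
    (hμ2 : SahiPositive μ 2) (hν2 : SahiPositive ν 2)
    (a : Fin 3 → γ → ℝ) (b : Fin 3 → β → ℝ) (ha0 : ∀ i t, 0 ≤ a i t) (ha1 : ∀ i t, a i t ≤ 1) (ham : ∀ i, Monotone (a i))
    (hb0 : ∀ i t, 0 ≤ b i t) (hb1 : ∀ i t, b i t ≤ 1) (hbm : ∀ i, Monotone (b i))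
    (hea : 0 ≤ sahiE μ 3 a) (heb : 0 ≤ sahiE ν 3 b) (g : Fin 3 → Bool) (hsort1 : g 1 = true → g 0 = true) (hsort2 : g 2 = true → g 1 = true) :
    0 ≤ sahiE (fun p : γ × β => μ p.1 * ν p.2) 3
      (fun (i : Fin 3) (p : γ × β) => cond (g i) (a i p.1 + b i p.2 - a i p.1 * b i p.2) (a i p.1 * b i p.2)) := by
  cases h2 : g 2
  · cases h1 : g 1
    · cases h0 : g 0
      · -- fff = AAA
        have h := sahiE_three_pand_nonneg_of_sahiPositive_two μ ν hμ0 hν0 hμ2 hν2 a b ha0 ham hb0 hbm hea heb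
        have e : (fun (i : Fin 3) (p : γ × β) => cond (g i) (a i p.1 + b i p.2 - a i p.1 * b i p.2) (a i p.1 * b i p.2)) =
            fun (i : Fin 3) (p : γ × β) => a i p.1 * b i p.2 := by
          funext i p
          fin_cases i <;> simp [h0, h1, h2]
        rw [e]; exact h
      · -- tff = OAA
        have h := sahiE_three_oaa_nonneg_of_sahiPositive_two μ ν hμ0 hμ1 hν0 hν1 hμ2 hν2 a b ha0 ha1 ham hb0 hb1 hbm hea heb
        have e : (fun (i : Fin 3) (p : γ × β) => cond (g i) (a i p.1 + b i p.2 - a i p.1 * b i p.2) (a i p.1 * b i p.2)) =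
            ![(fun p : γ × β => a 0 p.1 + b 0 p.2 - a 0 p.1 * b 0 p.2), (fun p : γ × β => a 1 p.1 * b 1 p.2),
              (fun p : γ × β => a 2 p.1 * b 2 p.2)] := by
          funext i p
          fin_cases i <;> simp [h0, h1, h2]
        rw [e]; exact h
    · have h0 : g 0 = true := hsort1 h1
      -- ttf = OOA
      have h := sahiE_three_ooa_nonneg_of_sahiPositive_two μ ν hμ0 hμ1 hν0 hν1 hμ2 hν2 a b ha0 ha1 ham hb0 hb1 hbm hea heb
      have e : (fun (i : Fin 3) (p : γ × β) => cond (g i) (a i p.1 + b i p.2 - a i p.1 * b i p.2) (a i p.1 * b i p.2)) =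
          ![(fun p : γ × β => a 0 p.1 + b 0 p.2 - a 0 p.1 * b 0 p.2), (fun p : γ × β => a 1 p.1 + b 1 p.2 - a 1 p.1 * b 1 p.2),
            (fun p : γ × β => a 2 p.1 * b 2 p.2)] := by
        funext i p
        fin_cases i <;> simp [h0, h1, h2]
      rw [e]; exact h
  · have h1 : g 1 = true := hsort2 h2
    have h0 : g 0 = true := hsort1 h1
    -- ttt = OOO
    have h := sahiE_three_por_nonneg_of_sahiPositive_two μ ν hμ0 hμ1 hν0 hν1 hμ2 hν2 a b ha0 ha1 ham hb0 hb1 hbm hea heb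
    have e : (fun (i : Fin 3) (p : γ × β) => cond (g i) (a i p.1 + b i p.2 - a i p.1 * b i p.2) (a i p.1 * b i p.2)) =
        fun (i : Fin 3) (p : γ × β) => a i p.1 + b i p.2 - a i p.1 * b i p.2 := by
      funext i p
      fin_cases i <;> simp [h0, h1, h2]
    rw [e]; exact h

/-- Reduction of an arbitrary gate vector to a sorted one along a permutation `σ` of the members: all hypotheses are permutation
invariant (`sahiE_comp_perm`). [this work] -/
theorem sahiE_three_gate_nonneg_of_perm (μ : γ → ℝ) (ν : β → ℝ)
    (hμ0 : ∀ t, 0 ≤ μ t) (hμ1 : ∑ t, μ t = 1) (hν0 : ∀ t, 0 ≤ ν t) (hν1 : ∑ t, ν t = 1)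
    (hμ2 : SahiPositive μ 2) (hν2 : SahiPositive ν 2)
    (a : Fin 3 → γ → ℝ) (b : Fin 3 → β → ℝ) (ha0 : ∀ i t, 0 ≤ a i t) (ha1 : ∀ i t, a i t ≤ 1) (ham : ∀ i, Monotone (a i))
    (hb0 : ∀ i t, 0 ≤ b i t) (hb1 : ∀ i t, b i t ≤ 1) (hbm : ∀ i, Monotone (b i))
    (hea : 0 ≤ sahiE μ 3 a) (heb : 0 ≤ sahiE ν 3 b) (g : Fin 3 → Bool) (σ : Equiv.Perm (Fin 3))
    (hsort1 : g (σ 1) = true → g (σ 0) = true) (hsort2 : g (σ 2) = true → g (σ 1) = true) :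
    0 ≤ sahiE (fun p : γ × β => μ p.1 * ν p.2) 3
      (fun (i : Fin 3) (p : γ × β) => cond (g i) (a i p.1 + b i p.2 - a i p.1 * b i p.2) (a i p.1 * b i p.2)) := by
  have hea' : 0 ≤ sahiE μ 3 (fun i => a (σ i)) := by rw [sahiE_comp_perm]; exact hea
  have heb' : 0 ≤ sahiE ν 3 (fun i => b (σ i)) := by rw [sahiE_comp_perm]; exact heb
  have h := sahiE_three_gate_nonneg_sorted μ ν hμ0 hμ1 hν0 hν1 hμ2 hν2 (fun i => a (σ i)) (fun i => b (σ i))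
    (fun i => ha0 (σ i)) (fun i => ha1 (σ i)) (fun i => ham (σ i)) (fun i => hb0 (σ i)) (fun i => hb1 (σ i)) (fun i => hbm (σ i))
    hea' heb' (fun i => g (σ i)) hsort1 hsort2
  rw [← sahiE_three_gate_comp_perm _ g a b σ]
  exact h

/-- **`E₃ ≥ 0` is preserved by every member-wise AND/OR gate between two independent positively associated blocks.**
`γ`, `β` finite preorders; `μ`, `ν` probability weights, Sahi-positive of order `2` (positive association / Harris–FKG); `a_i : γ → [0,1]`,
`b_i : β → [0,1]` monotone with `E₃(a_0,a_1,a_2) ≥ 0` under `μ` and `E₃(b_0,b_1,b_2) ≥ 0` under `ν`; `g : Fin 3 → Bool` ANY gate vector.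
Then the gate triple `u_i(x,y) = a_i(x) ⊕ b_i(y) − a_i(x)b_i(y)` (`g i = true`: OR, the indicator of `A_i × β ∪ γ × B_i` in the event case) /
`u_i(x,y) = a_i(x)b_i(y)` (`g i = false`: AND, `A_i × B_i`) satisfies `E₃^{μ⊗ν}(u_0,u_1,u_2) ≥ 0`.  Only `E₃` of the two given triples enters
beyond positive association: an INDUCTIVE STEP (see `sahiE_three_gate_nonneg_of_fkg`). [this work] -/
theorem sahiE_three_gate_nonneg_of_sahiPositive_two (μ : γ → ℝ) (ν : β → ℝ)
    (hμ0 : ∀ t, 0 ≤ μ t) (hμ1 : ∑ t, μ t = 1) (hν0 : ∀ t, 0 ≤ ν t) (hν1 : ∑ t, ν t = 1)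
    (hμ2 : SahiPositive μ 2) (hν2 : SahiPositive ν 2)
    (a : Fin 3 → γ → ℝ) (b : Fin 3 → β → ℝ) (ha0 : ∀ i t, 0 ≤ a i t) (ha1 : ∀ i t, a i t ≤ 1) (ham : ∀ i, Monotone (a i))
    (hb0 : ∀ i t, 0 ≤ b i t) (hb1 : ∀ i t, b i t ≤ 1) (hbm : ∀ i, Monotone (b i))
    (hea : 0 ≤ sahiE μ 3 a) (heb : 0 ≤ sahiE ν 3 b) (g : Fin 3 → Bool) :
    0 ≤ sahiE (fun p : γ × β => μ p.1 * ν p.2) 3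
      (fun (i : Fin 3) (p : γ × β) => cond (g i) (a i p.1 + b i p.2 - a i p.1 * b i p.2) (a i p.1 * b i p.2)) := by
  have H := sahiE_three_gate_nonneg_of_perm μ ν hμ0 hμ1 hν0 hν1 hμ2 hν2 a b ha0 ha1 ham hb0 hb1 hbm hea heb g
  cases h0 : g 0 <;> cases h1 : g 1 <;> cases h2 : g 2
  · exact H 1 (by simp [h0, h1]) (by simp [h1, h2])                                  -- fff
  · exact H (Equiv.swap 0 2) (by simp [Equiv.swap_apply_def, h1, h2]) (by simp [Equiv.swap_apply_def, h0, h1])  -- fft : σ = (0 2)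
  · exact H (Equiv.swap 0 1) (by simp [h0, h1]) (by simp [Equiv.swap_apply_def, h0, h2])  -- ftf : σ = (0 1)
  · exact H (Equiv.swap 0 2) (by simp [Equiv.swap_apply_def, h1, h2]) (by simp [Equiv.swap_apply_def, h0, h1])  -- ftt : σ = (0 2)
  · exact H 1 (by simp [h0, h1]) (by simp [h1, h2])                                  -- tff
  · exact H (Equiv.swap 1 2) (by simp [Equiv.swap_apply_def, h0, h2]) (by simp [h1, h2])  -- tft : σ = (1 2)
  · exact H 1 (by simp [h0, h1]) (by simp [h1, h2])                                  -- ttf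
  · exact H 1 (by simp [h0, h1]) (by simp [h1, h2])                                  -- ttt

end Gates

/-! ### The iteration package on FKG lattices, and the unconditional two-block instance `2^X × 2^Y`, `|X|, |Y| ≤ 4` -/

section FKG

variable {γ β : Type*} [Fintype γ] [Fintype β] [DistribLattice γ] [DistribLattice β]

/-- **Inductive step, FKG form.**  Two finite distributive lattices with FKG probability weights `μ`, `ν`; monotone `[0,1]`-valued triples
`a`, `b` with `E₃(a) ≥ 0`, `E₃(b) ≥ 0`; any gate vector `g`.  Then the gate triple on `γ × β` has `E₃ ≥ 0` under `μ ⊗ ν` — and (`isFKGMeasure_prod`,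
`monotone_gateSlot`, `gateSlot_nonneg`, `gateSlot_le_one`) the product block again satisfies every hypothesis except the new `E₃ ≥ 0`, which is the
conclusion: the step ITERATES over any binary bracketing of independent FKG blocks with arbitrary gates at each node ("gate-separable triples"),
down to leaf blocks where `C₃` is known. [this work] -/
theorem sahiE_three_gate_nonneg_of_fkg {μ : γ → ℝ} {ν : β → ℝ} (hμ : IsFKGMeasure μ) (hν : IsFKGMeasure ν)
    (a : Fin 3 → γ → ℝ) (b : Fin 3 → β → ℝ) (ha0 : ∀ i t, 0 ≤ a i t) (ha1 : ∀ i t, a i t ≤ 1) (ham : ∀ i, Monotone (a i))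
    (hb0 : ∀ i t, 0 ≤ b i t) (hb1 : ∀ i t, b i t ≤ 1) (hbm : ∀ i, Monotone (b i))
    (hea : 0 ≤ sahiE μ 3 a) (heb : 0 ≤ sahiE ν 3 b) (g : Fin 3 → Bool) :
    0 ≤ sahiE (fun p : γ × β => μ p.1 * ν p.2) 3
      (fun (i : Fin 3) (p : γ × β) => cond (g i) (a i p.1 + b i p.2 - a i p.1 * b i p.2) (a i p.1 * b i p.2)) :=
  sahiE_three_gate_nonneg_of_sahiPositive_two μ ν hμ.nonneg hμ.sum_eq_one hν.nonneg hν.sum_eq_one (sahiPositive_two hμ) (sahiPositive_two hν)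
    a b ha0 ha1 ham hb0 hb1 hbm hea heb g

/-- **Unconditional two-block instance with internal FKG dependence**: on `2^X × 2^Y` with `|X|, |Y| ≤ 4` and ANY two FKG probability weights
(`C₃` on `2^X`, `|X| ≤ 4`, every FKG weight: tree `SahiC3CubeFourFKG.sahiPositive_three_set_of_card_le_four`), every gate triple of
monotone `[0,1]`-valued block functions — e.g. the indicators of `A_i × 2^Y ∪ 2^X × B_i` or `A_i × B_i`, member by member, for up-sets `A_i`,
`B_i` — has `E₃ ≥ 0` under the product weight (two independent blocks of up to four spins each with arbitrary ferromagnetic internal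
dependence). [this work] -/
theorem sahiE_three_gate_nonneg_set_of_card_le_four {X Y : Type*} [Fintype X] [Fintype Y]
    (hX : Fintype.card X ≤ 4) (hY : Fintype.card Y ≤ 4)
    {μ : Set X → ℝ} {ν : Set Y → ℝ} (hμ : IsFKGMeasure μ) (hν : IsFKGMeasure ν)
    (a : Fin 3 → Set X → ℝ) (b : Fin 3 → Set Y → ℝ) (ha0 : ∀ i t, 0 ≤ a i t) (ha1 : ∀ i t, a i t ≤ 1) (ham : ∀ i, Monotone (a i))
    (hb0 : ∀ i t, 0 ≤ b i t) (hb1 : ∀ i t, b i t ≤ 1) (hbm : ∀ i, Monotone (b i)) (g : Fin 3 → Bool) :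
    0 ≤ sahiE (fun p : Set X × Set Y => μ p.1 * ν p.2) 3
      (fun (i : Fin 3) (p : Set X × Set Y) => cond (g i) (a i p.1 + b i p.2 - a i p.1 * b i p.2) (a i p.1 * b i p.2)) :=
  sahiE_three_gate_nonneg_of_fkg hμ hν a b ha0 ha1 ham hb0 hb1 hbm
    (SahiC3CubeFourFKG.sahiPositive_three_set_of_card_le_four hX hμ a ha0 ham)
    (SahiC3CubeFourFKG.sahiPositive_three_set_of_card_le_four hY hν b hb0 hbm) g

/-- **Three FKG blocks, two gate layers** (the step applied twice, as a worked instance of the iteration): blocks `2^X`, `2^Y`, `2^Z` with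
`|X|, |Y|, |Z| ≤ 4` and any FKG weights; inner gates `g` between the `X`- and `Y`-functions, outer gates `g'` with the `Z`-functions. [this work] -/
theorem sahiE_three_gate_nonneg_set_three_blocks {X Y Z : Type*} [Fintype X] [Fintype Y] [Fintype Z]
    (hX : Fintype.card X ≤ 4) (hY : Fintype.card Y ≤ 4) (hZ : Fintype.card Z ≤ 4)
    {μ : Set X → ℝ} {ν : Set Y → ℝ} {ρ : Set Z → ℝ} (hμ : IsFKGMeasure μ) (hν : IsFKGMeasure ν) (hρ : IsFKGMeasure ρ)
    (a : Fin 3 → Set X → ℝ) (b : Fin 3 → Set Y → ℝ) (c : Fin 3 → Set Z → ℝ)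
    (ha0 : ∀ i t, 0 ≤ a i t) (ha1 : ∀ i t, a i t ≤ 1) (ham : ∀ i, Monotone (a i))
    (hb0 : ∀ i t, 0 ≤ b i t) (hb1 : ∀ i t, b i t ≤ 1) (hbm : ∀ i, Monotone (b i))
    (hc0 : ∀ i t, 0 ≤ c i t) (hc1 : ∀ i t, c i t ≤ 1) (hcm : ∀ i, Monotone (c i)) (g g' : Fin 3 → Bool) :
    0 ≤ sahiE (fun q : (Set X × Set Y) × Set Z => (μ q.1.1 * ν q.1.2) * ρ q.2) 3
      (fun (i : Fin 3) (q : (Set X × Set Y) × Set Z) =>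
        cond (g' i)
          (cond (g i) (a i q.1.1 + b i q.1.2 - a i q.1.1 * b i q.1.2) (a i q.1.1 * b i q.1.2) + c i q.2
            - cond (g i) (a i q.1.1 + b i q.1.2 - a i q.1.1 * b i q.1.2) (a i q.1.1 * b i q.1.2) * c i q.2)
          (cond (g i) (a i q.1.1 + b i q.1.2 - a i q.1.1 * b i q.1.2) (a i q.1.1 * b i q.1.2) * c i q.2)) :=
  sahiE_three_gate_nonneg_of_fkg (isFKGMeasure_prod hμ hν) hρ
    (fun (i : Fin 3) (p : Set X × Set Y) => cond (g i) (a i p.1 + b i p.2 - a i p.1 * b i p.2) (a i p.1 * b i p.2)) c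
    (fun i p => gateSlot_nonneg (g i) (ha0 i p.1) (hb0 i p.2) (hb1 i p.2))
    (fun i p => gateSlot_le_one (g i) (ha1 i p.1) (hb0 i p.2) (hb1 i p.2))
    (fun i => monotone_gateSlot (g i) (ha0 i) (ha1 i) (ham i) (hb0 i) (hb1 i) (hbm i)) hc0 hc1 hcm
    (sahiE_three_gate_nonneg_set_of_card_le_four hX hY hμ hν a b ha0 ha1 ham hb0 hb1 hbm g)
    (SahiC3CubeFourFKG.sahiPositive_three_set_of_card_le_four hZ hρ c hc0 hcm) g'

end FKG

end Summit.CriticalPhenomena.PercolationContinuityZ3.Theorems.SahiE3UnionTensor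

end
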